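import Mathlib.Topology.Instances.ZMod
import Mathlib.Topology.Algebra.Constructions
import Mathlib.GroupTheory.Perm.Fin
import Literature.IUT.HodgeTheaters.TemperedCoveringsCor23Cor25ClosureCertificates
import HarnessLib

/-!
# [IUTchI] Cor. 2.3 (iv), (vi), Cor. 2.5 (decomposition part): the predicates `Cor23iv`, `Cor23vi`,
# `Cor25Decomposition` on `StableCurveTemperedData` are SCHEMAS — universal-closure certificates (proof-only)

S. Mochizuki, *Inter-universal Teichmüller theory I*, kurims manuscript (May 2020), §2, Corollary 2.3 (iv), (vi)
pp. 47–48 and Corollary 2.5 p. 51 [claim: Mochizuki2012, status: disputed] (IUTchI §2 Cor 2.3 / Cor 2.5, kurims pp.47-51).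
abc-iut cell, FACT-LIST rows of layer L5 (seat abc-iut-w6-d089 gen 5, row «KL5-CLOSURE-CERTS»).  PROOF-ONLY sequel of
abc-iut-w4-d007's `TemperedCoveringsCor23Cor25ClosureCertificates.lean` (which decided F-2593 `Cor23ii`, F-2595 `Cor23iii`,
F-2597 `Cor23v`, F-2603 `Cor25Inertia`); companion of abc-iut-L5-t1's `TemperedCoverings.lean` (no `def`, no `instance`,
nothing re-typed).

The three frozen FACT-LIST rows **F-2596** `StableCurveTemperedData.Cor23iv`, **F-2598** `…Cor23vi`, **F-2602**
`…Cor25Decomposition` were «LABEL-OPEN, conditional/instance events only» (plan/LF-KERNEL-STATUS 2026-08-27T02:19Z): an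
instance-form / conditional theorem existed, a universal-closure decision did not.  Each is a `Prop`-valued structure on an
ARBITRARY `D : StableCurveTemperedData` — an interface record whose fields (`Π^tp_X ↪ Π̂_X ↠ G_k`, the special-fibre data
`Π^tp_ℍ ⊆ Π^tp_𝔾 ↪ Π̂_𝔾 ⊇ Π̂_ℍ`, cusps with representative inertia groups AND the free atom «the cusp meets a component in `ℍ`»,
points with representative decomposition groups) are constrained only by the structure's axioms.  The interface admits
DEGENERATE (finite) inhabitants at which the three predicates fail, so their universal closures are false and the rows are
consumable AT THE GENUINE DATUM ONLY (FACT-LIST class «universal-closure REFUTED / schema; instance forms are the content»).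
Instance-form theorems already in the tree (not touched here): F-2596 — `cor23iv_of_cor23i`, `cor23iv_of_slim_of_stable`,
abc-iut-w4-d052's `cor23_i_to_v_ofSpecialFibre_…` chain; F-2598 — `cor23vi_of_graph`, `cor23vi_of_graph_top`,
`cor23vi_iff_of_graph_top`; F-2602 — `cor25Decomposition_of_prop24ii`, `cor25Decomposition_ofSpecialFibre`.

WHICH DEGENERATION KILLS WHICH CLAUSE (general lemmas first):
* `not_cor23iv_of_ne_top` — if `Π^tp_X` is FINITE then every subgroup is commensurable with each of its conjugates, so
  «`Π^tp_{X,ℍ}` commensurably terminal» forces `Π^tp_{X,ℍ} = Π^tp_X`; (iv) fails as soon as hypothesis (a)/(b) holds and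
  `Δ^tp_{X,ℍ}` is NOT normal in `Π^tp_X`;
* `not_cor23vi_of_atom` — the (vi)(b) atom `cuspMeetsH` is FREE DATA: a cusp with representative inertia group `1` and atom
  `False` falsifies (vi) (its left-hand side holds with `d = 1`);
* `not_cor25Decomposition_of_not_normal` — for `Σ̂ = Primes`, a point with representative decomposition group `1` and an
  element `γ ∈ Π̂_X` NOT normalising `Π^tp_X` falsify the second clause of Cor. 2.5 (its left-hand side holds with `t = 1`).
TWO FINITE DEGENERATE DATA (inline, no definition; discrete topologies): (1) `Π^tp_𝔾 = Π̂_𝔾 = Π^tp_X = Π̂_X = 𝔖₃` (`ι = id`),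
`Π^tp_ℍ = Π̂_ℍ =` the stabiliser of `2 ∈ {0,1,2}` (a transposition subgroup, not normal), `G_k = 1`, `Σ = {3} ⊆ Σ̂ = Primes`,
`p = 2`, ONE cusp with `I = 1` and atom `False`: kills (iv) and (vi); (2) `Π^tp_X =` that transposition subgroup `↪ Π̂_X = 𝔖₃`,
`Π^tp_𝔾 = Π̂_𝔾 = 1`, `G_k = 1`, `Σ̂ = Primes`, one point with `D = 1`: kills Cor. 2.5 (decomposition part), `γ` = another
transposition.  Then the three closed certificates `not_forall_cor23iv`, `not_forall_cor23vi`, `not_forall_cor25Decomposition`.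

HONEST FRAMING: a refuted universal closure is a statement about OUR typing (the interface record admits degenerate
inhabitants), not about the printed corollaries, which concern the genuine tempered/profinite fundamental groups of a pointed
stable curve (there `Π^tp_X` is infinite and centre-free, the atom (vi)(b) is determined by the stable model, `Π^tp_X ↪ Π̂_X`
is dense); the genuine instances are the theorems listed above.  Nothing here bears on [IUTchIII] Cor. 3.12 or takes a side;
typed ≠ proved; refuted-as-typed ≠ refuted-in-print; nothing asserts abc proved or refuted.
-/

namespace Literature.IUT.HodgeTheaters

namespace StableCurveTemperedData

open Topology
open scoped Pointwise
open Literature.AnabelianGeometry.AbsoluteAnabelian (IsCommensurablyTerminal)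

universe u

variable (D : StableCurveTemperedData.{u})

/-! ## Which degeneration kills which clause -/

/-- In a FINITE group every subgroup is commensurable with each of its conjugates (all indices are finite and non-zero), so a
commensurably terminal subgroup is the whole group. [folklore] -/
private theorem eq_top_of_isCommensurablyTerminal_of_finite {G : Type*} [Group G] [Finite G] {K : Subgroup G}
    (h : IsCommensurablyTerminal K) : K = ⊤ := by
  rw [← h.commensurator_eq, eq_top_iff]
  intro g _
  rw [Subgroup.Commensurable.commensurator_mem_iff]
  exact ⟨Subgroup.index_ne_zero_of_finite, Subgroup.index_ne_zero_of_finite⟩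

/-- **IUTchI:Cor2.3(iv)** (kurims p.47) fails whenever its hypothesis (a)/(b) holds, `Π^tp_X` is FINITE and
`Π^tp_{X,ℍ} ≠ Π^tp_X` (i.e. `Δ^tp_{X,ℍ}` is not normal in `Π^tp_X`): in a finite group only the whole group is commensurably
terminal. [claim: Mochizuki2012, status: disputed] (IUTchI §2 Cor 2.3 (iv), kurims p.47) -/
theorem not_cor23iv_of_ne_top (hhyp : D.Cor23Hyp) [Finite D.PiTp] (h : D.piTpXH ≠ ⊤) : ¬ D.Cor23iv :=
  fun hc => h (eq_top_of_isCommensurablyTerminal_of_finite (hc.tp hhyp))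

/-- **IUTchI:Cor2.3(vi)** (kurims p.48) fails whenever some cusp carries the representative inertia group `1` and the atom
«meets an irreducible component contained in `ℍ`» set to `False`: the atom is free data of the interface, while
`1 ⊆ d · Δ^tp_{X,ℍ} · d⁻¹` holds with `d = 1`. [claim: Mochizuki2012, status: disputed] (IUTchI §2 Cor 2.3 (vi), kurims p.48) -/
theorem not_cor23vi_of_atom (x : D.Cusp) (hI : D.inertiaTp x = ⊥) (hx : ¬ D.cuspMeetsH x) : ¬ D.Cor23vi :=
  fun hc => hx ((hc.tp x).mp ⟨1, by rw [hI]; exact bot_le⟩)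

/-- **IUTchI:Cor2.5** (kurims p.51), decomposition part, fails whenever `Σ̂ = Primes`, some point carries the representative
decomposition group `1`, and some `γ ∈ Π̂_X` does NOT normalise `Π^tp_X`: the second clause's left-hand side holds with
`t = 1` (`1 ⊆ γ · Π^tp_X · γ⁻¹`), its right-hand side says `γ · Π^tp_X · γ⁻¹ = Π^tp_X`.
[claim: Mochizuki2012, status: disputed] (IUTchI §2 Cor 2.5, kurims p.51) -/
theorem not_cor25Decomposition_of_not_normal (hS : D.graph.SigmaHat = {q | q.Prime}) (x : D.Pt)
    (hx : D.decompTp x = ⊥) (γ : D.PiHat) (hγ : MulAut.conj γ • D.ιX.range ≠ D.ιX.range) :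
    ¬ D.Cor25Decomposition := fun hc =>
  hγ ((hc.conj_eq_iff hS γ).mp ⟨x, 1, by rw [hx, map_one, one_smul, Subgroup.map_bot]; exact bot_le⟩)

/-! ## Two finite degenerate inhabitants and the three closed certificates -/

/-- **A finite degenerate inhabitant falsifying Cor. 2.3 (iv) and (vi)**: `Π^tp_𝔾 = Π̂_𝔾 = Π^tp_X = Π̂_X = 𝔖₃` (discrete,
`ι = id`), `Π^tp_ℍ = Π̂_ℍ = Stab(2)` (a transposition subgroup — not normal), `G_k = 1`, `Σ = {3}`, `Σ̂ = Primes`, `p = 2`,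
one cusp with inertia representative `1` and atom `False`, one point with decomposition representative `1`.
[claim: Mochizuki2012, status: disputed] (IUTchI §2 Cor 2.3 (iv)(vi), kurims pp.47-48) -/
theorem exists_not_cor23iv_cor23vi : ∃ D : StableCurveTemperedData.{0}, ¬ D.Cor23iv ∧ ¬ D.Cor23vi := by
  letI : TopologicalSpace (Equiv.Perm (Fin 3)) := ⊥
  haveI : DiscreteTopology (Equiv.Perm (Fin 3)) := discreteTopology_bot _
  let T : Subgroup (Equiv.Perm (Fin 3)) := MulAction.stabilizer (Equiv.Perm (Fin 3)) (2 : Fin 3)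
  let G : TemperedGraphGroupData.{0} :=
    { Sigma := {3}
      SigmaHat := {q | q.Prime}
      sigma_subset := by
        intro q hq
        rw [Set.mem_singleton_iff] at hq
        subst hq
        exact Nat.prime_three
      sigma_nonempty := ⟨3, rfl⟩
      sigmaHat_prime := fun _ hq => hq
      Tp := Equiv.Perm (Fin 3)
      Hat := Equiv.Perm (Fin 3)
      ι := MonoidHom.id _
      ι_continuous := continuous_id
      ι_injective := fun _ _ h => h
      TpH := T
      HatH := T
      tpH_le := (Subgroup.map_id T).le }
  let D : StableCurveTemperedData.{0} :=
    { graph := G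
      p := 2
      p_notMem := by
        show (2 : ℕ) ∉ ({3} : Set ℕ)
        simp
      PiTp := Equiv.Perm (Fin 3)
      PiHat := Equiv.Perm (Fin 3)
      Gk := Multiplicative (ZMod 1)
      ιX := MonoidHom.id _
      ιX_continuous := continuous_id
      ιX_injective := fun _ _ h => h
      prTp := 1
      prHat := 1
      prTp_surjective := fun _ => ⟨1, Subsingleton.elim _ _⟩
      prHat_comp := by ext; exact Subsingleton.elim _ _
      ρTp := (1 : Equiv.Perm (Fin 3) →* Multiplicative (ZMod 1)).ker.subtype
      ρHat := (1 : Equiv.Perm (Fin 3) →* Multiplicative (ZMod 1)).ker.subtype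
      ρTp_surjective := fun x => ⟨⟨x, by simp⟩, rfl⟩
      ρHat_surjective := fun x => ⟨⟨x, by simp⟩, rfl⟩
      ρ_comp := fun _ => rfl
      Cusp := PUnit
      inertiaTp := fun _ => ⊥
      cuspMeetsH := fun _ => False
      Pt := PUnit
      decompTp := fun _ => ⊥ }
  have hS : D.graph.SigmaHat = {q | q.Prime} := rfl
  have hhyp : D.Cor23Hyp := ⟨Or.inr hS⟩
  -- `Δ^tp_{X,ℍ} ⊆ Π^tp_X` is the transposition subgroup `T = Stab(2)` of `𝔖₃`
  have hmap : (D.deltaTpH.map D.DeltaTp.subtype : Subgroup D.PiTp) = T := by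
    show Subgroup.map (1 : Equiv.Perm (Fin 3) →* Multiplicative (ZMod 1)).ker.subtype
      (T.comap (1 : Equiv.Perm (Fin 3) →* Multiplicative (ZMod 1)).ker.subtype) = T
    rw [Subgroup.map_comap_eq, Subgroup.range_subtype, MonoidHom.ker_one, top_inf_eq]
  -- the transposition `(1 2)` does not normalise `Stab(2) = {1, (0 1)}`: it conjugates `(0 1)` to `(0 2)`
  have h01 : Equiv.swap (0 : Fin 3) 1 ∈ T := by
    show Equiv.swap (0 : Fin 3) 1 ∈ MulAction.stabilizer (Equiv.Perm (Fin 3)) (2 : Fin 3)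
    rw [MulAction.mem_stabilizer_iff, Equiv.Perm.smul_def]
    decide
  have hconj : Equiv.swap (1 : Fin 3) 2 * Equiv.swap (0 : Fin 3) 1 * (Equiv.swap (1 : Fin 3) 2)⁻¹ ∉ T := by
    show _ ∉ MulAction.stabilizer (Equiv.Perm (Fin 3)) (2 : Fin 3)
    rw [MulAction.mem_stabilizer_iff, Equiv.Perm.smul_def]
    decide
  have hne : D.piTpXH ≠ ⊤ := by
    intro h
    have hc : Equiv.swap (1 : Fin 3) 2 ∈ D.piTpXH := by
      rw [h]
      exact Subgroup.mem_top _
    rw [piTpXH, hmap, Subgroup.mem_normalizer_iff] at hc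
    exact hconj ((hc _).mp h01)
  exact ⟨D, D.not_cor23iv_of_ne_top hhyp hne, D.not_cor23vi_of_atom PUnit.unit rfl not_false⟩

/-- **A finite degenerate inhabitant falsifying Cor. 2.5 (decomposition part)**: `Π^tp_X = Stab(2) ↪ Π̂_X = 𝔖₃` (discrete;
`Π^tp_X` not normal), `Π^tp_𝔾 = Π̂_𝔾 = 1`, `G_k = 1`, `Σ = {3}`, `Σ̂ = Primes`, `p = 2`, no cusps, one point with
decomposition representative `1`; `γ = (1 2)`. [claim: Mochizuki2012, status: disputed] (IUTchI §2 Cor 2.5, kurims p.51) -/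
theorem exists_not_cor25Decomposition : ∃ D : StableCurveTemperedData.{0}, ¬ D.Cor25Decomposition := by
  letI : TopologicalSpace (Equiv.Perm (Fin 3)) := ⊥
  haveI : DiscreteTopology (Equiv.Perm (Fin 3)) := discreteTopology_bot _
  let T : Subgroup (Equiv.Perm (Fin 3)) := MulAction.stabilizer (Equiv.Perm (Fin 3)) (2 : Fin 3)
  let G : TemperedGraphGroupData.{0} :=
    { Sigma := {3}
      SigmaHat := {q | q.Prime}
      sigma_subset := by
        intro q hq
        rw [Set.mem_singleton_iff] at hq
        subst hq
        exact Nat.prime_three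
      sigma_nonempty := ⟨3, rfl⟩
      sigmaHat_prime := fun _ hq => hq
      Tp := Multiplicative (ZMod 1)
      Hat := Multiplicative (ZMod 1)
      ι := MonoidHom.id _
      ι_continuous := continuous_id
      ι_injective := fun _ _ h => h
      TpH := ⊥
      HatH := ⊤
      tpH_le := le_top }
  let D : StableCurveTemperedData.{0} :=
    { graph := G
      p := 2
      p_notMem := by
        show (2 : ℕ) ∉ ({3} : Set ℕ)
        simp
      PiTp := T
      PiHat := Equiv.Perm (Fin 3)
      Gk := Multiplicative (ZMod 1)
      ιX := T.subtype
      ιX_continuous := continuous_subtype_val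
      ιX_injective := Subtype.val_injective
      prTp := 1
      prHat := 1
      prTp_surjective := fun _ => ⟨1, Subsingleton.elim _ _⟩
      prHat_comp := by ext; exact Subsingleton.elim _ _
      ρTp := 1
      ρHat := 1
      ρTp_surjective := fun _ => ⟨1, Subsingleton.elim _ _⟩
      ρHat_surjective := fun _ => ⟨1, Subsingleton.elim _ _⟩
      ρ_comp := fun _ => Subsingleton.elim _ _
      Cusp := PEmpty
      inertiaTp := fun x => nomatch x
      cuspMeetsH := fun _ => True
      Pt := PUnit
      decompTp := fun _ => ⊥ }
  have hS : D.graph.SigmaHat = {q | q.Prime} := rfl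
  have hrange : D.ιX.range = T := Subgroup.range_subtype T
  have h01 : Equiv.swap (0 : Fin 3) 1 ∈ T := by
    show Equiv.swap (0 : Fin 3) 1 ∈ MulAction.stabilizer (Equiv.Perm (Fin 3)) (2 : Fin 3)
    rw [MulAction.mem_stabilizer_iff, Equiv.Perm.smul_def]
    decide
  have hconj : Equiv.swap (1 : Fin 3) 2 * Equiv.swap (0 : Fin 3) 1 * (Equiv.swap (1 : Fin 3) 2)⁻¹ ∉ T := by
    show _ ∉ MulAction.stabilizer (Equiv.Perm (Fin 3)) (2 : Fin 3)
    rw [MulAction.mem_stabilizer_iff, Equiv.Perm.smul_def]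
    decide
  have hγ : MulAut.conj (Equiv.swap (1 : Fin 3) 2) • D.ιX.range ≠ D.ιX.range := by
    intro h
    rw [hrange] at h
    have hmem : MulAut.conj (Equiv.swap (1 : Fin 3) 2) • Equiv.swap (0 : Fin 3) 1 ∈
        MulAut.conj (Equiv.swap (1 : Fin 3) 2) • T := Subgroup.smul_mem_pointwise_smul _ _ _ h01
    rw [h, MulAut.smul_def, MulAut.conj_apply] at hmem
    exact hconj hmem
  exact ⟨D, D.not_cor25Decomposition_of_not_normal hS PUnit.unit rfl _ hγ⟩

/-- **F-2596 is a schema**: the universal closure of `StableCurveTemperedData.Cor23iv` is FALSE (instance forms for the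
cone: `cor23iv_of_cor23i`, `cor23iv_of_slim_of_stable`, the special-fibre chain `cor23_i_to_v_ofSpecialFibre_…`).
[claim: Mochizuki2012, status: disputed] (IUTchI §2 Cor 2.3 (iv), kurims p.47) -/
theorem not_forall_cor23iv : ¬ ∀ D : StableCurveTemperedData.{0}, D.Cor23iv := fun h => by
  obtain ⟨D, h1, -⟩ := exists_not_cor23iv_cor23vi
  exact h1 (h D)

/-- **F-2598 is a schema**: the universal closure of `StableCurveTemperedData.Cor23vi` is FALSE (instance forms for the
cone: `cor23vi_of_graph`, `cor23vi_of_graph_top`, `cor23vi_iff_of_graph_top` — at data whose atom (vi)(b) is the one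
determined by the special fibre). [claim: Mochizuki2012, status: disputed] (IUTchI §2 Cor 2.3 (vi), kurims p.48) -/
theorem not_forall_cor23vi : ¬ ∀ D : StableCurveTemperedData.{0}, D.Cor23vi := fun h => by
  obtain ⟨D, -, h2⟩ := exists_not_cor23iv_cor23vi
  exact h2 (h D)

/-- **F-2602 is a schema**: the universal closure of `StableCurveTemperedData.Cor25Decomposition` is FALSE (instance forms
for the cone: `cor25Decomposition_of_prop24ii`, `cor25Decomposition_ofSpecialFibre`).
[claim: Mochizuki2012, status: disputed] (IUTchI §2 Cor 2.5, kurims p.51) -/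
theorem not_forall_cor25Decomposition : ¬ ∀ D : StableCurveTemperedData.{0}, D.Cor25Decomposition := fun h => by
  obtain ⟨D, hD⟩ := exists_not_cor25Decomposition
  exact hD (h D)

/-- The three rows are SCHEMAS side by side: each universal closure fails, while the tree holds instance-form theorems
(cited in the docstrings above) — «universal-closure REFUTED / schema; instance forms are the content».
[claim: Mochizuki2012, status: disputed] (IUTchI §2 Cor 2.3 (iv)(vi) / Cor 2.5, kurims pp.47-51) -/
theorem cor23iv_cor23vi_cor25Decomposition_closures_refuted :
    (¬ ∀ D : StableCurveTemperedData.{0}, D.Cor23iv) ∧ (¬ ∀ D : StableCurveTemperedData.{0}, D.Cor23vi) ∧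
      ¬ ∀ D : StableCurveTemperedData.{0}, D.Cor25Decomposition :=
  ⟨not_forall_cor23iv, not_forall_cor23vi, not_forall_cor25Decomposition⟩

/-! ## Appendix (same seat, row «KL5-CLOSURE-CERTS-5»): Cor. 2.3 (i), FACT-LIST row F-2592 `Cor23i`

`Cor23i D` asks `Δ^tp_{X,ℍ} ⊆ Δ^tp_X` and `Δ̂_{X,ℍ} ⊆ Δ̂_X` to be commensurably terminal; conditional closers in tree:
`cor23i_of_prop22` (under [IUTchI] Prop. 2.2 for the graph data), `cor23i_of_graph_top`, and abc-iut-w4-d052's special-fibre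
chain.  In a FINITE `Δ^tp_X` only the whole group is commensurably terminal (the lemma above), so the row fails as soon as
`Δ^tp_{X,ℍ} ≠ Δ^tp_X` — e.g. at abc-iut-w4-d007's degenerate `ℤ/2`-datum with `Π^tp_ℍ = 1` (rebuilt inline below). -/

/-- **IUTchI:Cor2.3(i)** (kurims p.47) fails whenever `Δ^tp_X` is FINITE and `Δ^tp_{X,ℍ} ≠ Δ^tp_X`: in a finite group only
the whole group is commensurably terminal. [claim: Mochizuki2012, status: disputed] (IUTchI §2 Cor 2.3 (i), kurims p.47) -/
theorem not_cor23i_of_ne_top [Finite D.DeltaTp] (h : D.deltaTpH ≠ ⊤) : ¬ D.Cor23i :=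
  fun hc => h (eq_top_of_isCommensurablyTerminal_of_finite hc.tp)

/-- **A finite degenerate inhabitant falsifying Cor. 2.3 (i)**: `Π^tp_𝔾 = Π̂_𝔾 = Π^tp_X = Π̂_X = ℤ/2ℤ` (discrete, `ι = id`),
`G_k = 1`, `Σ = {3}`, `Σ̂ = Primes`, `p = 2`, `Π^tp_ℍ = 1`, `Π̂_ℍ = ℤ/2ℤ`, no cusps (abc-iut-w4-d007's datum): `Δ^tp_{X,ℍ} = 1`
is not commensurably terminal in `Δ^tp_X = ℤ/2ℤ`. [claim: Mochizuki2012, status: disputed] (IUTchI §2 Cor 2.3 (i), kurims p.47) -/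
theorem exists_not_cor23i : ∃ D : StableCurveTemperedData.{0}, ¬ D.Cor23i := by
  let G : TemperedGraphGroupData.{0} :=
    { Sigma := {3}
      SigmaHat := {q | q.Prime}
      sigma_subset := by
        intro q hq
        rw [Set.mem_singleton_iff] at hq
        subst hq
        exact Nat.prime_three
      sigma_nonempty := ⟨3, rfl⟩
      sigmaHat_prime := fun _ hq => hq
      Tp := Multiplicative (ZMod 2)
      Hat := Multiplicative (ZMod 2)
      ι := MonoidHom.id _
      ι_continuous := continuous_id
      ι_injective := fun _ _ h => h
      TpH := ⊥
      HatH := ⊤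
      tpH_le := le_top }
  let D : StableCurveTemperedData.{0} :=
    { graph := G
      p := 2
      p_notMem := by
        show (2 : ℕ) ∉ ({3} : Set ℕ)
        simp
      PiTp := Multiplicative (ZMod 2)
      PiHat := Multiplicative (ZMod 2)
      Gk := Multiplicative (ZMod 1)
      ιX := MonoidHom.id _
      ιX_continuous := continuous_id
      ιX_injective := fun _ _ h => h
      prTp := 1
      prHat := 1
      prTp_surjective := fun _ => ⟨1, Subsingleton.elim _ _⟩
      prHat_comp := by ext; exact Subsingleton.elim _ _
      ρTp := (1 : Multiplicative (ZMod 2) →* Multiplicative (ZMod 1)).ker.subtype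
      ρHat := (1 : Multiplicative (ZMod 2) →* Multiplicative (ZMod 1)).ker.subtype
      ρTp_surjective := fun x => ⟨⟨x, by simp⟩, rfl⟩
      ρHat_surjective := fun x => ⟨⟨x, by simp⟩, rfl⟩
      ρ_comp := fun _ => rfl
      Cusp := PEmpty
      inertiaTp := fun x => nomatch x
      cuspMeetsH := fun _ => True
      Pt := PUnit
      decompTp := fun _ => ⊤ }
  have hT : D.graph.TpH = ⊥ := rfl
  have hρ : Function.Injective D.ρTp := Subtype.val_injective
  have h1 : D.deltaTpH = ⊥ := by
    rw [deltaTpH, hT, MonoidHom.comap_bot, MonoidHom.ker_eq_bot_iff]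
    exact hρ
  -- the non-trivial element `-1 ∈ ℤ/2ℤ = Δ^tp_X` (the kernel of `Π^tp_X ↠ G_k = 1` is everything)
  have hmem : (Multiplicative.ofAdd (1 : ZMod 2)) ∈ D.DeltaTp := by simp [D]
  let z : D.DeltaTp := ⟨Multiplicative.ofAdd (1 : ZMod 2), hmem⟩
  have hz1 : z ≠ 1 := by
    intro h
    have h' : Multiplicative.ofAdd (1 : ZMod 2) = (1 : Multiplicative (ZMod 2)) := congrArg Subtype.val h
    exact absurd h' (by decide)
  haveI : Nontrivial D.DeltaTp := ⟨⟨z, 1, hz1⟩⟩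
  have hne : D.deltaTpH ≠ ⊤ := by
    rw [h1]
    exact bot_ne_top
  exact ⟨D, D.not_cor23i_of_ne_top hne⟩

/-- **F-2592 is a schema**: the universal closure of `StableCurveTemperedData.Cor23i` is FALSE; the content is the
conditional closers `cor23i_of_prop22` / `cor23i_of_graph_top` and the special-fibre chain of abc-iut-w4-d052.
[claim: Mochizuki2012, status: disputed] (IUTchI §2 Cor 2.3 (i), kurims p.47) -/
theorem not_forall_cor23i : ¬ ∀ D : StableCurveTemperedData.{0}, D.Cor23i := fun h => by
  obtain ⟨D, hD⟩ := exists_not_cor23i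
  exact hD (h D)

end StableCurveTemperedData

end Literature.IUT.HodgeTheaters
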